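import Summits.AtomisticToContinuum.FouriersLaw.Theses.ParabolicBathMap

/-!
# BC3 birth skeleton — crux `ResistanceQuantum` (stmt-AtomisticToContinuum-11922) of route ParabolicBathMap

Crux (route decl `Summit.AtomisticToContinuum.FouriersLaw.Theses.ParabolicBathMap.ResistanceQuantum`):
for `pinnedChain ω₂ lam β γ` (all `> 0`), under uniqueness of weak steady states, for every
`T > 0` there is `a > 0` such that along every steady-state family and every conductance sequence
`G` (`G N = lim_δ totalCurrent/((N-1)δ)`, `N ≥ 2`) with `G → 0` and `G N > 0`:
eventually `a ≤ (G (N+1))⁻¹ - (G N)⁻¹` (one more site costs at least one resistance quantum).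

## The line (two stubs, multiplicative split of the resistance quantum)

Write `R_N = (G N)⁻¹` (chain resistance) and `D_N = (N-1) G N` (finite-size conductivity).
The insertion resistance factorises as

  `R_{N+1} - R_N = [ (R_{N+1} - R_N) / (R_N / N) ] · [ R_N / N ]`
                 = (RELATIVE insertion cost) · (mean resistance per site).

* `stub_orbitBoundedResponse` — BOUNDED RESPONSE ALONG THE ORBIT: `∃ M, eventually D_N ≤ M`,
  i.e. `R_N / N ≳ 1/M`: the finite-size conductivity of the pinned anharmonic chain is bounded in
  the length (the `HasBoundedResponse` waypoint of the catalogue entry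
  `Literature.Barriers.AtomisticToContinuum.HasBoundedResponse`, restricted to the recurrent,
  Ohmic orbit; BLR 2000 §6.3 "dependence of `D` on `L`"). NO statement about increments.
* `stub_scaleFreeInsertionCost` — SCALE-FREE INSERTION COST: `∃ θ > 0`, eventually
  `θ · R_N / N ≤ R_{N+1} - R_N`: the `(N+1)`-th site is at least `θ` times as resistive as the
  average of the first `N` (no intermittent "free" insertions / ballistic windows along the
  orbit). Dimensionless and scale-invariant: it holds verbatim for anomalous chains
  (`R_N ∼ N^α`, `θ < α`) and for insulating ones, so it carries NO bound on `D_N` and does not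
  give the crux by itself.

Assembly (seam `resistanceQuantum_of_stubs`, sorry-free; skeleton theorem `ResistanceQuantum_of :
ParabolicBathMap.ResistanceQuantum := seam stub₁ stub₂`): eventually `R_N ≥ (N-1)/max M 1 ≥ N /(2 max M 1)` (`N ≥ 2`), so
`R_{N+1} - R_N ≥ θ R_N / N ≥ θ / (2 max M 1) =: a > 0`. Real proof below (no sorry).

Disproof used: no `Disproof.lean` exists for this crux yet (`ledger crux ls`: no workfiles); the
refuter's crux-attack (Evidence.lean, 2026-08-15) shows the soft antecedents `G → 0`, `G N > 0`
alone do not force the conclusion (`G N = (N+2+(-1)^N)⁻¹`) — both stubs are statements about the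
PHYSICAL conductance sequence (pinnedChain steady states), not about arbitrary sequences, and the
alternating witness violates `stub_scaleFreeInsertionCost` (negative increments), as it must.
-/

namespace Summit.AtomisticToContinuum.FouriersLaw.Cruxes.ResistanceQuantum.Birth

open MeasureTheory Filter Topology
open Literature.MathematicalPhysics.KineticTheory.HeatConduction

/-- STUB A — bounded response along the recurrent Ohmic orbit: under uniqueness of weak steady
states, for every `T > 0` there is `M` such that along every steady-state family and every
conductance sequence `G` (`N ≥ 2`) with `G → 0`, `G N > 0`, eventually `(N - 1) · G N ≤ M`
(the finite-size conductivity `D_N = (N-1) G_N` is bounded in `N`; BLR 2000 §6.3; catalogue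
`Literature.Barriers.AtomisticToContinuum.HasBoundedResponse` along the orbit). -/
theorem stub_orbitBoundedResponse :
    ∀ ω₂ lam β γ : ℝ, 0 < ω₂ → 0 < lam → 0 < β → 0 < γ →
    (∀ (N : ℕ) (T_L T_R : ℝ), 0 < T_L → 0 < T_R → ∀ μ ν : Measure (PhaseSpace N),
      (pinnedChain ω₂ lam β γ).IsSteadyState N T_L T_R μ →
      (pinnedChain ω₂ lam β γ).IsSteadyState N T_L T_R ν → μ = ν) →
    ∀ T : ℝ, 0 < T → ∃ M : ℝ, ∀ μ : (N : ℕ) → ℝ → ℝ → Measure (PhaseSpace N),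
      (∀ (N : ℕ) (T_L T_R : ℝ), 0 < T_L → 0 < T_R →
        (pinnedChain ω₂ lam β γ).IsSteadyState N T_L T_R (μ N T_L T_R)) →
      ∀ G : ℕ → ℝ, (∀ N : ℕ, 2 ≤ N → Tendsto (fun δ : ℝ =>
        (pinnedChain ω₂ lam β γ).totalCurrent (μ N (T + δ / 2) (T - δ / 2)) / (((N : ℝ) - 1) * δ))
        (𝓝[≠] 0) (𝓝 (G N))) →
      Tendsto G atTop (𝓝 0) → (∀ N : ℕ, 2 ≤ N → 0 < G N) →
      ∀ᶠ N : ℕ in atTop, ((N : ℝ) - 1) * G N ≤ M := by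
  sorry

/-- STUB B — scale-free insertion cost: under uniqueness of weak steady states, for every `T > 0`
there is `θ > 0` such that along every steady-state family and every conductance sequence `G`
(`N ≥ 2`) with `G → 0`, `G N > 0`, eventually `θ · (G N)⁻¹ / N ≤ (G (N+1))⁻¹ - (G N)⁻¹`:
the resistance added by one more site is at least the fraction `θ` of the running mean
resistance per site (no intermittent free insertions along the orbit of the bath map). -/
theorem stub_scaleFreeInsertionCost :
    ∀ ω₂ lam β γ : ℝ, 0 < ω₂ → 0 < lam → 0 < β → 0 < γ →
    (∀ (N : ℕ) (T_L T_R : ℝ), 0 < T_L → 0 < T_R → ∀ μ ν : Measure (PhaseSpace N),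
      (pinnedChain ω₂ lam β γ).IsSteadyState N T_L T_R μ →
      (pinnedChain ω₂ lam β γ).IsSteadyState N T_L T_R ν → μ = ν) →
    ∀ T : ℝ, 0 < T → ∃ θ : ℝ, 0 < θ ∧ ∀ μ : (N : ℕ) → ℝ → ℝ → Measure (PhaseSpace N),
      (∀ (N : ℕ) (T_L T_R : ℝ), 0 < T_L → 0 < T_R →
        (pinnedChain ω₂ lam β γ).IsSteadyState N T_L T_R (μ N T_L T_R)) →
      ∀ G : ℕ → ℝ, (∀ N : ℕ, 2 ≤ N → Tendsto (fun δ : ℝ =>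
        (pinnedChain ω₂ lam β γ).totalCurrent (μ N (T + δ / 2) (T - δ / 2)) / (((N : ℝ) - 1) * δ))
        (𝓝[≠] 0) (𝓝 (G N))) →
      Tendsto G atTop (𝓝 0) → (∀ N : ℕ, 2 ≤ N → 0 < G N) →
      ∀ᶠ N : ℕ in atTop, θ * ((G N)⁻¹ / (N : ℝ)) ≤ (G (N + 1))⁻¹ - (G N)⁻¹ := by
  sorry

/-- SEAM (real proof, sorry-free): bounded response along the orbit and the scale-free insertion cost
give the resistance quantum `a := θ / (2 · max M 1)`: eventually `(G N)⁻¹ ≥ (N-1)/max M 1 ≥ N/(2 max M 1)`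
(`N ≥ 2`), hence `(G (N+1))⁻¹ - (G N)⁻¹ ≥ θ (G N)⁻¹ / N ≥ a`. Statement:
`stub_orbitBoundedResponse`-signature → `stub_scaleFreeInsertionCost`-signature → the DEFINIENS of
`ParabolicBathMap.ResistanceQuantum` verbatim (so that `ResistanceQuantum_of` below is this term at the
crux's NAME, and is the only theorem of the file concluding the crux by name). -/
theorem resistanceQuantum_of_stubs :
    (∀ ω₂ lam β γ : ℝ, 0 < ω₂ → 0 < lam → 0 < β → 0 < γ →
    (∀ (N : ℕ) (T_L T_R : ℝ), 0 < T_L → 0 < T_R → ∀ μ ν : Measure (PhaseSpace N),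
      (pinnedChain ω₂ lam β γ).IsSteadyState N T_L T_R μ →
      (pinnedChain ω₂ lam β γ).IsSteadyState N T_L T_R ν → μ = ν) →
    ∀ T : ℝ, 0 < T → ∃ M : ℝ, ∀ μ : (N : ℕ) → ℝ → ℝ → Measure (PhaseSpace N),
      (∀ (N : ℕ) (T_L T_R : ℝ), 0 < T_L → 0 < T_R →
        (pinnedChain ω₂ lam β γ).IsSteadyState N T_L T_R (μ N T_L T_R)) →
      ∀ G : ℕ → ℝ, (∀ N : ℕ, 2 ≤ N → Tendsto (fun δ : ℝ =>
        (pinnedChain ω₂ lam β γ).totalCurrent (μ N (T + δ / 2) (T - δ / 2)) / (((N : ℝ) - 1) * δ))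
        (𝓝[≠] 0) (𝓝 (G N))) →
      Tendsto G atTop (𝓝 0) → (∀ N : ℕ, 2 ≤ N → 0 < G N) →
      ∀ᶠ N : ℕ in atTop, ((N : ℝ) - 1) * G N ≤ M) →
    (∀ ω₂ lam β γ : ℝ, 0 < ω₂ → 0 < lam → 0 < β → 0 < γ →
    (∀ (N : ℕ) (T_L T_R : ℝ), 0 < T_L → 0 < T_R → ∀ μ ν : Measure (PhaseSpace N),
      (pinnedChain ω₂ lam β γ).IsSteadyState N T_L T_R μ →
      (pinnedChain ω₂ lam β γ).IsSteadyState N T_L T_R ν → μ = ν) →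
    ∀ T : ℝ, 0 < T → ∃ θ : ℝ, 0 < θ ∧ ∀ μ : (N : ℕ) → ℝ → ℝ → Measure (PhaseSpace N),
      (∀ (N : ℕ) (T_L T_R : ℝ), 0 < T_L → 0 < T_R →
        (pinnedChain ω₂ lam β γ).IsSteadyState N T_L T_R (μ N T_L T_R)) →
      ∀ G : ℕ → ℝ, (∀ N : ℕ, 2 ≤ N → Tendsto (fun δ : ℝ =>
        (pinnedChain ω₂ lam β γ).totalCurrent (μ N (T + δ / 2) (T - δ / 2)) / (((N : ℝ) - 1) * δ))
        (𝓝[≠] 0) (𝓝 (G N))) →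
      Tendsto G atTop (𝓝 0) → (∀ N : ℕ, 2 ≤ N → 0 < G N) →
      ∀ᶠ N : ℕ in atTop, θ * ((G N)⁻¹ / (N : ℝ)) ≤ (G (N + 1))⁻¹ - (G N)⁻¹) →
    (∀ ω₂ lam β γ : ℝ, 0 < ω₂ → 0 < lam → 0 < β → 0 < γ →
    (∀ (N : ℕ) (T_L T_R : ℝ), 0 < T_L → 0 < T_R → ∀ μ ν : Measure (PhaseSpace N),
      (pinnedChain ω₂ lam β γ).IsSteadyState N T_L T_R μ →
      (pinnedChain ω₂ lam β γ).IsSteadyState N T_L T_R ν → μ = ν) →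
    ∀ T : ℝ, 0 < T → ∃ a : ℝ, 0 < a ∧ ∀ μ : (N : ℕ) → ℝ → ℝ → Measure (PhaseSpace N),
      (∀ (N : ℕ) (T_L T_R : ℝ), 0 < T_L → 0 < T_R →
        (pinnedChain ω₂ lam β γ).IsSteadyState N T_L T_R (μ N T_L T_R)) →
      ∀ G : ℕ → ℝ, (∀ N : ℕ, 2 ≤ N → Tendsto (fun δ : ℝ =>
        (pinnedChain ω₂ lam β γ).totalCurrent (μ N (T + δ / 2) (T - δ / 2)) / (((N : ℝ) - 1) * δ))
        (𝓝[≠] 0) (𝓝 (G N))) →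
      Tendsto G atTop (𝓝 0) → (∀ N : ℕ, 2 ≤ N → 0 < G N) →
      ∀ᶠ N : ℕ in atTop, a ≤ (G (N + 1))⁻¹ - (G N)⁻¹) := by
  intro hA hB ω₂ lam β γ hω hl hβ hγ hU T hT
  obtain ⟨M, hM⟩ := hA ω₂ lam β γ hω hl hβ hγ hU T hT
  obtain ⟨θ, hθ, hBθ⟩ := hB ω₂ lam β γ hω hl hβ hγ hU T hT
  have hM1 : 0 < max M 1 := lt_of_lt_of_le one_pos (le_max_right M 1)
  refine ⟨θ / (2 * max M 1), by positivity, fun μ hμ G hG h0 hpos => ?_⟩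
  filter_upwards [hM μ hμ G hG h0 hpos, hBθ μ hμ G hG h0 hpos, eventually_ge_atTop 2]
    with N hNM hNθ hN2
  have hGpos : 0 < G N := hpos N hN2
  have hN2' : (2 : ℝ) ≤ (N : ℝ) := by exact_mod_cast hN2
  have hNpos : (0 : ℝ) < (N : ℝ) := by linarith
  -- mean resistance per site is bounded below: (G N)⁻¹ ≥ (N - 1) / max M 1
  have hNM' : ((N : ℝ) - 1) * G N ≤ max M 1 := hNM.trans (le_max_left M 1)
  have hinv : ((N : ℝ) - 1) / max M 1 ≤ (G N)⁻¹ := by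
    rw [div_le_iff₀ hM1]
    calc ((N : ℝ) - 1) = (((N : ℝ) - 1) * G N) * (G N)⁻¹ := by
            field_simp
      _ ≤ max M 1 * (G N)⁻¹ := by
            gcongr
      _ = (G N)⁻¹ * max M 1 := mul_comm _ _
  have hmean : 1 / (2 * max M 1) ≤ (G N)⁻¹ / (N : ℝ) := by
    rw [div_le_div_iff₀ (by positivity) hNpos, one_mul]
    have h2 : ((N : ℝ) - 1) / max M 1 * (2 * max M 1) ≤ (G N)⁻¹ * (2 * max M 1) :=
      mul_le_mul_of_nonneg_right hinv (by positivity)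
    have h3 : ((N : ℝ) - 1) / max M 1 * (2 * max M 1) = 2 * ((N : ℝ) - 1) := by
      field_simp
    rw [h3] at h2
    linarith
  calc θ / (2 * max M 1) = θ * (1 / (2 * max M 1)) := by ring
    _ ≤ θ * ((G N)⁻¹ / (N : ℝ)) := by gcongr
    _ ≤ (G (N + 1))⁻¹ - (G N)⁻¹ := hNθ

/-- **Skeleton theorem — the crux `ParabolicBathMap.ResistanceQuantum` BY NAME from the two registered
stubs** (the only theorem of this file concluding the crux; its `sorry`s are exactly those of
`stub_orbitBoundedResponse` and `stub_scaleFreeInsertionCost`; the seam `resistanceQuantum_of_stubs`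
is sorry-free, axioms propext/Classical.choice/Quot.sound). -/
theorem ResistanceQuantum_of :
    _root_.Summit.AtomisticToContinuum.FouriersLaw.Theses.ParabolicBathMap.ResistanceQuantum :=
  resistanceQuantum_of_stubs stub_orbitBoundedResponse stub_scaleFreeInsertionCost

end Summit.AtomisticToContinuum.FouriersLaw.Cruxes.ResistanceQuantum.Birth
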